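import Summits.AtomisticToContinuum.Crystallization.Theorems.CoarseGrains.Negative.PredicateAPI

/-!
# Line `Sketch` (crux `FineGrains`, stmt-AtomisticToContinuum-9330): the pigeonhole ball

Stub `stub_pigeonholeBall` (P1) of the line skeleton (card tube-energy-gap-pigeonhole, cycle-2
reshape of `TubeRigidity` into tube energy gap (G) + pigeonhole (P1) + local flatness (P2)) —
elementary.

Statement: for every `ρ > 0` there are `M₀ > 0` and `R₀` such that for `R ≥ R₀`, every centre `c`,
every finite family of points `y : Fin n → ℝ³` and every non-negative pair weight `w`, some closed
ball `B_{ρ+5}(c')` well inside `B_{R-1}(c)` (namely `dist c' c + ρ + 8 ≤ R - 1`) carries at most a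
`(M₀ R³)⁻¹` fraction of the total weight of the pairs with both points in `B_{R-2}(c)`.

Proof (this file): grid spacing `L := 2ρ + 11 > 2 (ρ + 5)`; centres `c + (L k₀, L k₁, L k₂)` for
`k : Fin 3 → Fin (K + 1)`, `K := ⌊(R - ρ - 9) / (2 L)⌋₊`.  Every centre is within
`2 L K ≤ R - ρ - 9` of `c` (coordinates `≤ L K`, `√3 ≤ 2`), so it is admissible and its
`(ρ + 5)`-ball lies in `B_{R-2}(c)`.  Distinct centres are `≥ L > 2ρ + 10` apart (they differ by a
non-zero integer multiple of `L` in some coordinate), so a point lies in at most one of the balls;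
hence the local weights summed over the `(K + 1)³` centres are at most the total weight (swap the
sums, compare termwise), and the minimum is at most the average.  Finally
`K + 1 ≥ (R - ρ - 9) / (2 L) ≥ R / (4 L)` once `R ≥ 2ρ + 18`, so `(K + 1)³ ≥ R³ / (64 L³)`:
`M₀ := 1 / (64 L³)`, `R₀ := 2ρ + 18`.  All `[folklore]`; Mathlib only; no new definitions; nothing
here closes an item.
-/

noncomputable section

open Literature.MathematicalPhysics.StatisticalMechanics
open Summit.AtomisticToContinuum.Crystallization.Theorems.CoarseGrains.Negative.PredicateAPI

namespace Summit.AtomisticToContinuum.Crystallization.Theorems.ExcessDecayLiouvilleFineGrains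

/-! ### Coordinates in `ℝ³` and the cubic grid of spacing `L` -/

/-- `‖v‖ ≤ 2 B` when every coordinate of `v ∈ ℝ³` is at most `B` in absolute value (`√3 ≤ 2`).
[folklore] -/
theorem norm_le_two_mul_of_abs_apply_le {v : E3} {B : ℝ} (hB : 0 ≤ B) (h : ∀ l, |v l| ≤ B) :
    ‖v‖ ≤ 2 * B := by
  have hsq : ‖v‖ ^ 2 = v 0 ^ 2 + v 1 ^ 2 + v 2 ^ 2 := by
    rw [EuclideanSpace.real_norm_sq_eq, Fin.sum_univ_three]
  have hb : ∀ l, v l ^ 2 ≤ B ^ 2 := fun l => by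
    rw [← sq_abs (v l)]
    exact pow_le_pow_left₀ (abs_nonneg _) (h l) 2
  have h2 : ‖v‖ ^ 2 ≤ (2 * B) ^ 2 := by
    rw [hsq]; nlinarith [hb 0, hb 1, hb 2, sq_nonneg B]
  exact (sq_le_sq₀ (norm_nonneg _) (by positivity)).1 h2

/-- Distinct points `g k = (L k₀, L k₁, L k₂)` of the cubic grid of spacing `L ≥ 0` are `≥ L` apart:
they differ by a non-zero integer multiple of `L` in some coordinate, and a coordinate is bounded by
the Euclidean norm. [folklore] -/
theorem le_norm_grid_sub {L : ℝ} (hL : 0 ≤ L) {g : (Fin 3 → ℕ) → E3}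
    (hg : ∀ k l, g k l = L * (k l : ℝ)) {k k' : Fin 3 → ℕ} (h : k ≠ k') :
    L ≤ ‖g k - g k'‖ := by
  obtain ⟨l, hl⟩ := Function.ne_iff.1 h
  have hcoord : (g k - g k') l = L * ((k l : ℝ) - k' l) := by
    rw [PiLp.sub_apply, hg, hg, mul_sub]
  have h1 : 1 ≤ |(k l : ℝ) - k' l| := by
    rcases lt_or_gt_of_ne hl with hlt | hlt
    · have h' : (k l : ℝ) + 1 ≤ k' l := by exact_mod_cast Nat.succ_le_of_lt hlt
      rw [abs_sub_comm]
      exact le_trans (by linarith) (le_abs_self _)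
    · have h' : (k' l : ℝ) + 1 ≤ k l := by exact_mod_cast Nat.succ_le_of_lt hlt
      exact le_trans (by linarith) (le_abs_self _)
  calc L = L * 1 := (mul_one L).symm
    _ ≤ L * |(k l : ℝ) - k' l| := mul_le_mul_of_nonneg_left h1 hL
    _ = |(g k - g k') l| := by rw [hcoord, abs_mul, abs_of_nonneg hL]
    _ ≤ ‖g k - g k'‖ := abs_apply_le_norm _ l

/-! ### Two counting lemmas -/

/-- Pigeonhole bookkeeping for one pair of points: if at most one cell `k` satisfies `A`, and
`A k ∧ B k` forces `C`, then `∑ k, [A k ∧ B k] a ≤ [C] a` for `a ≥ 0`. [folklore] -/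
theorem sum_ite_and_le {κ : Type*} [Fintype κ] {A B : κ → Prop} [DecidablePred A]
    [DecidablePred B] {C : Prop} [Decidable C] {a : ℝ} (ha : 0 ≤ a)
    (huniq : ∀ k k', A k → A k' → k = k') (hC : ∀ k, A k → B k → C) :
    (∑ k, if A k ∧ B k then a else 0) ≤ if C then a else 0 := by
  by_cases hex : ∃ k, A k ∧ B k
  · obtain ⟨k₀, hA, hB⟩ := hex
    rw [Fintype.sum_eq_single k₀ fun k hk => if_neg fun h' => hk (huniq k k₀ h'.1 hA),
      if_pos ⟨hA, hB⟩, if_pos (hC k₀ hA hB)]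
  · push Not at hex
    rw [Finset.sum_eq_zero fun k _ => if_neg fun h' => hex k h'.1 h'.2]
    split_ifs
    · exact ha
    · exact le_rfl

/-- Minimum ≤ average: on a non-empty finite type some value of `f` times the cardinality is at most
the sum. [folklore] -/
theorem exists_card_mul_le_sum_univ {κ : Type*} [Fintype κ] [Nonempty κ] (f : κ → ℝ) :
    ∃ k, (Fintype.card κ : ℝ) * f k ≤ ∑ k, f k := by
  obtain ⟨k₀, -, hk₀⟩ := Finset.exists_min_image Finset.univ f Finset.univ_nonempty
  refine ⟨k₀, ?_⟩
  have h := Finset.card_nsmul_le_sum Finset.univ f (f k₀) fun k hk => hk₀ k hk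
  rwa [Finset.card_univ, nsmul_eq_mul] at h

/-! ### The stub -/

/-- **stub_pigeonholeBall** (P1; stub of line `Sketch`, crux `FineGrains`
stmt-AtomisticToContinuum-9330, elementary): for a non-negative pair weight `w` on finitely many
points, some ball `B_{ρ+5}(c')` well inside `B_{R-1}(c)` (`dist c' c + ρ + 8 ≤ R - 1`) carries at
most a `(M₀ R³)⁻¹` fraction of the total weight of the pairs inside `B_{R-2}(c)` — a cubic grid of
`(K+1)³ ≥ R³ / (64 L³)` centres `L = 2ρ + 11` apart makes the `(ρ+5)`-balls pairwise disjoint, so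
the local weights sum to at most the total, and the minimum is at most the average.  Constants:
`M₀ = 1 / (64 (2ρ + 11)³)`, `R₀ = 2ρ + 18`. [folklore] -/
theorem stub_pigeonholeBall :
    ∀ ρ : ℝ, 0 < ρ → ∃ M₀ : ℝ, 0 < M₀ ∧ ∃ R₀ : ℝ, ∀ R : ℝ, R₀ ≤ R →
    ∀ (c : E3) (n : ℕ) (y : Fin n → E3) (w : Fin n → Fin n → ℝ), (∀ i j : Fin n, 0 ≤ w i j) →
      ∃ c' : E3, dist c' c + ρ + 8 ≤ R - 1 ∧
        M₀ * R ^ 3 * (∑ i : Fin n, ∑ j : Fin n,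
            if dist (y i) c' ≤ ρ + 5 ∧ dist (y j) c' ≤ ρ + 5 then w i j else 0) ≤
          ∑ i : Fin n, ∑ j : Fin n,
            if dist (y i) c ≤ R - 2 ∧ dist (y j) c ≤ R - 2 then w i j else 0 := by
  intro ρ hρ
  -- grid spacing `L > 2 (ρ + 5)`: closed `(ρ + 5)`-balls around distinct grid points are disjoint
  obtain ⟨L, hL⟩ : ∃ L : ℝ, L = 2 * ρ + 11 := ⟨_, rfl⟩
  have hLpos : 0 < L := by rw [hL]; linarith
  refine ⟨1 / (64 * L ^ 3), by positivity, 2 * ρ + 18, ?_⟩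
  intro R hR c n y w hw
  have hRpos : 0 < R := by linarith
  -- number of grid steps per axis
  obtain ⟨K, hKle, hKlt⟩ : ∃ K : ℕ, (K : ℝ) ≤ (R - ρ - 9) / (2 * L) ∧
      (R - ρ - 9) / (2 * L) < (K : ℝ) + 1 :=
    ⟨⌊(R - ρ - 9) / (2 * L)⌋₊, Nat.floor_le (div_nonneg (by linarith) (by linarith)),
      Nat.lt_floor_add_one _⟩
  have h2LK : 2 * L * K ≤ R - ρ - 9 := by
    have h' := (le_div_iff₀ (by positivity : (0 : ℝ) < 2 * L)).1 hKle
    linarith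
  -- the grid of spacing `L` and the centres `c + (L k₀, L k₁, L k₂)`, `k : Fin 3 → Fin (K + 1)`
  obtain ⟨g, hg⟩ : ∃ g : (Fin 3 → ℕ) → E3, ∀ k l, g k l = L * (k l : ℝ) :=
    ⟨fun k => WithLp.toLp 2 fun l => L * (k l : ℝ), fun k l => rfl⟩
  obtain ⟨ctr, hctr⟩ : ∃ ctr : (Fin 3 → Fin (K + 1)) → E3,
      ∀ k, ctr k = c + g (fun l => (k l : ℕ)) := ⟨_, fun k => rfl⟩
  have hdist_ctr : ∀ k, dist (ctr k) c ≤ R - ρ - 9 := fun k => by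
    rw [hctr k, dist_eq_norm, add_sub_cancel_left]
    refine (norm_le_two_mul_of_abs_apply_le (by positivity : (0 : ℝ) ≤ L * K) fun l => ?_).trans
      (by linarith)
    have hkl : ((k l : ℕ) : ℝ) ≤ K := by exact_mod_cast Nat.lt_succ_iff.1 (k l).isLt
    have hgl : g (fun l => (k l : ℕ)) l = L * ((k l : ℕ) : ℝ) := hg _ _
    rw [hgl, abs_of_nonneg (by positivity)]
    exact mul_le_mul_of_nonneg_left hkl hLpos.le
  -- a point lies in at most one of the balls
  have huniq : ∀ (p : E3) (k k' : Fin 3 → Fin (K + 1)),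
      dist p (ctr k) ≤ ρ + 5 → dist p (ctr k') ≤ ρ + 5 → k = k' := by
    intro p k k' hk hk'
    by_contra hne
    have hne' : (fun l => ((k l : Fin (K + 1)) : ℕ)) ≠ fun l => ((k' l : Fin (K + 1)) : ℕ) :=
      fun h' => hne (funext fun l => Fin.ext (congr_fun h' l))
    have hsep := le_norm_grid_sub hLpos.le hg hne'
    have hd : dist (ctr k) (ctr k') = ‖g (fun l => (k l : ℕ)) - g (fun l => (k' l : ℕ))‖ := by
      rw [hctr k, hctr k', dist_eq_norm, add_sub_add_left_eq_sub]
    have htri : dist (ctr k) (ctr k') ≤ dist p (ctr k) + dist p (ctr k') := by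
      rw [dist_comm p (ctr k)]
      exact dist_triangle _ _ _
    linarith
  -- each small ball lies inside `B_{R-2}(c)`
  have hin : ∀ (p : E3) (k : Fin 3 → Fin (K + 1)), dist p (ctr k) ≤ ρ + 5 → dist p c ≤ R - 2 := by
    intro p k hk
    linarith [dist_triangle p (ctr k) c, hdist_ctr k]
  -- double count: the local weights summed over all centres are at most the total weight
  have hsum : (∑ k : Fin 3 → Fin (K + 1), ∑ i : Fin n, ∑ j : Fin n,
      if dist (y i) (ctr k) ≤ ρ + 5 ∧ dist (y j) (ctr k) ≤ ρ + 5 then w i j else 0) ≤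
      ∑ i : Fin n, ∑ j : Fin n,
        if dist (y i) c ≤ R - 2 ∧ dist (y j) c ≤ R - 2 then w i j else 0 := by
    calc (∑ k : Fin 3 → Fin (K + 1), ∑ i : Fin n, ∑ j : Fin n,
          if dist (y i) (ctr k) ≤ ρ + 5 ∧ dist (y j) (ctr k) ≤ ρ + 5 then w i j else 0)
        = ∑ i : Fin n, ∑ j : Fin n, ∑ k : Fin 3 → Fin (K + 1),
            if dist (y i) (ctr k) ≤ ρ + 5 ∧ dist (y j) (ctr k) ≤ ρ + 5 then w i j else 0 := by
          rw [Finset.sum_comm]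
          exact Finset.sum_congr rfl fun i _ => Finset.sum_comm
      _ ≤ _ := Finset.sum_le_sum fun i _ => Finset.sum_le_sum fun j _ =>
          sum_ite_and_le (hw i j) (fun k k' hk hk' => huniq (y i) k k' hk hk')
            (fun k hk hk' => ⟨hin (y i) k hk, hin (y j) k hk'⟩)
  -- minimum ≤ average over the `(K + 1)³` centres
  obtain ⟨k₀, hk₀⟩ := exists_card_mul_le_sum_univ fun k : Fin 3 → Fin (K + 1) =>
    ∑ i : Fin n, ∑ j : Fin n,
      if dist (y i) (ctr k) ≤ ρ + 5 ∧ dist (y j) (ctr k) ≤ ρ + 5 then w i j else 0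
  rw [Fintype.card_fun, Fintype.card_fin, Fintype.card_fin] at hk₀
  push_cast at hk₀
  -- the count: `(K + 1)³ ≥ R³ / (64 L³)`
  have hK1 : R / (4 * L) ≤ (K : ℝ) + 1 := by
    have h' : R / (4 * L) ≤ (R - ρ - 9) / (2 * L) := by
      rw [div_le_div_iff₀ (by positivity) (by positivity)]
      nlinarith
    linarith
  have hM : 1 / (64 * L ^ 3) * R ^ 3 ≤ ((K : ℝ) + 1) ^ 3 := by
    calc 1 / (64 * L ^ 3) * R ^ 3 = (R / (4 * L)) ^ 3 := by field_simp; ring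
      _ ≤ ((K : ℝ) + 1) ^ 3 := pow_le_pow_left₀ (by positivity) hK1 3
  have hloc0 : 0 ≤ ∑ i : Fin n, ∑ j : Fin n,
      if dist (y i) (ctr k₀) ≤ ρ + 5 ∧ dist (y j) (ctr k₀) ≤ ρ + 5 then w i j else 0 :=
    Finset.sum_nonneg fun i _ => Finset.sum_nonneg fun j _ => by
      split_ifs
      · exact hw i j
      · exact le_rfl
  refine ⟨ctr k₀, by linarith [hdist_ctr k₀], ?_⟩
  calc 1 / (64 * L ^ 3) * R ^ 3 * (∑ i : Fin n, ∑ j : Fin n,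
          if dist (y i) (ctr k₀) ≤ ρ + 5 ∧ dist (y j) (ctr k₀) ≤ ρ + 5 then w i j else 0)
      ≤ ((K : ℝ) + 1) ^ 3 * (∑ i : Fin n, ∑ j : Fin n,
          if dist (y i) (ctr k₀) ≤ ρ + 5 ∧ dist (y j) (ctr k₀) ≤ ρ + 5 then w i j else 0) :=
        mul_le_mul_of_nonneg_right hM hloc0
    _ ≤ _ := hk₀
    _ ≤ _ := hsum

end Summit.AtomisticToContinuum.Crystallization.Theorems.ExcessDecayLiouvilleFineGrains

end
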